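import Literature.Analysis.FluidPDE.LerayHopfMildH1Forced
import Literature.Analysis.FluidPDE.TaoBoundedTotalSpeedDischarge
import Literature.Analysis.FluidPDE.TaoForcedUniquenessClayForce
import HarnessLib

/-!
# Tao 2011, Prop. 9.1 (bounded total speed) WITH FORCE, and Cor. 11.4 for Clay-class forces: the proofs

Analysis/FluidPDE file (cell `pub/ns-blowup`, seat `ns-blowup-lean2` g0, PATH A of LADDER-NS N1's support
item `TaoForcedUniqueness`; bears_on: `route-NavierStokesRegularity-PalasekTowerBreakdown`). WHAT THIS
IS NOT: not a statement about the Navier–Stokes regularity problem — an a priori estimate for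
classical solutions of the FORCED system that are already Leray–Hopf.

It is the **forced twin** of the tree's `f = 0` Prop. 9.1 chain (`TaoDuhamelSpeedPointwise`,
`TaoDuhamelSpeedMajorant`, `TaoBoundedTotalSpeedDischarge`), at a general viscosity `ν > 0`, and
supplies the one remaining analytic input ("finite total speed") of the forced Cor. 11.4
reduction `tao2011_forced_unconditionalUniqueness_velocity_of_totalSpeed`
(`TaoForcedUniquenessApriori`) and of its Clay-class form
`tao2011_forced_unconditionalUniqueness_velocity_schwartzForce_of_totalSpeed`
(`TaoForcedUniquenessClayForce`) — and then closes the latter: the last section proves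
**Tao 2011, Cor. 11.4 WITH a Clay-class (Schwartz) force**,
`tao2011_forced_unconditionalUniqueness_velocity_schwartzForce_holds`, i.e. VERBATIM the conclusion
of the tree's corollary `tao2011_forced_unconditionalUniqueness_velocity.schwartzForce`
(`TaoForcedUniquenessSchwartzForce`) without its hypothesis (the named fact
`tao2011_forced_unconditionalUniqueness_velocity`, which — stated for the general smooth
`L^∞_t H¹_x` force class — stays a cited fact).

## Main results (all proved)

* `eLpNorm_lerayHeatTest_le`: `‖P(G_σ(·-x₀)e)‖_{L²} ≤ C σ^{-3/4}‖e‖`, `C` the dispersive constant —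
  by DUALITY: pair the `L²_σ` field with itself (`integral_inner_lerayHeatTest`) and use the
  dispersive inequality on `e^{σΔ}P(G_σ e) = P(G_{2σ} e)`.
* `lintegral_lintegral_speedMajorant_visc_le`: the Schur-test bound (9.7) of the Fourier majorant
  at viscosity `ν`, `∫₀ᵀ M_ν ≤ (6S/(ν(2π)⁴)) ∫₀ᵀ∫|∇U|²_F` (the `t`-integral of the heat symbol
  `e^{-4π²ν(t-τ)|ξ|²}` is `(ν(2π)²|ξ|²)⁻¹`).
* `enorm_sub_heatExtension_le_speedMajorant_forced`: the pointwise Duhamel bound WITH force,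
  `‖u(t,x₀) − e^{νtΔ}u(0)(x₀)‖ ≤ 2π M_ν(t) + C F_ν(t)`,
  `F_ν(t) = ∫_{0<τ<t} (ν(t-τ))^{-3/4}‖f(τ)‖_{L²} dτ`, from the tested Duhamel formula WITH force
  (`IsLerayHopfOn.integral_inner_eq_mild_of_hasWeakGradient_forced`, `LerayHopfMildH1Forced`)
  against `φ = P(G_ε(·-x₀)e)` and `ε → 0⁺`.
* `lintegral_lintegral_forceMajorant_le`: `∫₀ᵀ F_ν ≤ 4ν^{-3/4}T^{1/4} ∫₀ᵀ ‖f‖_{L²}` (Tonelli on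
  the triangle `{0 < τ < t < T}`).
* `lintegral_eLpNorm_top_lt_top_forced` — **Tao 2011, Prop. 9.1 WITH FORCE (qualitative a priori
  form)**: a classical solution of the forced system on `[0,T] × ℝ³` (`ν > 0`) which is Leray–Hopf
  from `u(0)` with force `f ∈ L²_{t,x}`, of finite energy and finite dissipation, has
  `∫₀ᵀ ‖u(t)‖_{L^∞} dt < ∞`.
* `IsClassicalNSSolutionOn.totalSpeed_lt_top_of_clayForce`: its hypotheses discharged for a
  Clay-class force (Leray–Hopf via `isLerayHopfOn_of_finiteEnergy_forced_ae` with the PROVED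
  corrected pressure normalisation `tao2011_forced_pressure_normalisation_ae_holds` and
  `clayForce_slice_potential_bounds`; `f ∈ L²((0,T) × ℝ³)` by continuity and the uniform slice
  bound; dissipation by `dissipation_lt_top_of_clayForce`).
* `tao2011_forced_unconditionalUniqueness_velocity_schwartzForce_holds` — **Tao 2011, Cor. 11.4
  (arXiv Cor. 71) WITH a Clay-class force, velocity form, PROVED**: `ν > 0`, `0 < T`, datum
  `u₀, ∇u₀ ∈ L²`, force smooth on `[0,∞) × ℝ³` with Fefferman's decay (5), two classical solutions
  of the forced system on `[0,T] × ℝ³` from `u₀` with finite energy ⇒ they agree on `[0,T]`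
  (`…_schwartzForce_of_totalSpeed` fed with `totalSpeed_lt_top_of_clayForce`).

## Proof

Tao's proof of Prop. 9.1 (arXiv:1108.1165, §9, pp. 27–28) kept with its force term: by (9.2),
`u(t) = e^{νtΔ}u₀ + ∫₀ᵗ e^{ν(t-τ)Δ}(Pf − P∇·(u⊗u))(τ) dτ`; the free term is acceptable by the
dispersive inequality and (9.6), the force term by
`‖e^{ν(t-τ)Δ}Pf(τ)‖_{L^∞} ≲ (ν(t-τ))^{-3/4}‖f(τ)‖_{L²}` (here through the `L²` norm of the
Leray-projected heat kernel, no Leray projection of `f` being needed on the test side), and the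
nonlinear term by the frequency-side majorant and Schur's test ((9.7)). The tree's `f = 0` files
are followed verbatim; only the heat-symbol time integrals are redone at viscosity `ν` and the
force majorant is added.

## References

* T. Tao, *Localisation and compactness properties of the Navier–Stokes global regularity
  problem*, Anal. PDE 6 (2013) 25–107 = arXiv:1108.1165v2: Prop. 9.1 (arXiv Prop. 52, p. 27),
  proof §9 (9.2)–(9.7), §2 (dispersive inequality) (`Tao2011`).
* E. B. Fabes, B. F. Jones, N. M. Rivière, Arch. Rational Mech. Anal. 45 (1972), Thm. 2.1
  (`FabesJonesRiviere1972`).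
* C. Fefferman, Clay problem description, (4)–(7) (`FeffermanClay2006`).
-/

noncomputable section

open MeasureTheory TopologicalSpace Set Function Filter Topology InnerProductSpace Real
open scoped RealInnerProductSpace ENNReal NNReal FourierTransform ContDiff

namespace Literature.Analysis.FluidPDE

open UnboundedOperators

/-! ## The `L²` norm of the Leray-projected heat kernel (duality with the dispersive estimate) -/

section LerayHeatTestL2

variable {x₀ e : EuclideanSpace ℝ (Fin 3)} {σ : ℝ}

/-- A continuous function on `ℝ³` is bounded by its `L^∞` norm at every point (Lebesgue measure
charges nonempty open sets; local copy of the helper of `OseenHeatLpBounds`). [folklore] -/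
private theorem enorm_apply_le_eLpNorm_top {G : Type*} [NormedAddCommGroup G]
    {h : EuclideanSpace ℝ (Fin 3) → G} (hh : Continuous h) (z : EuclideanSpace ℝ (Fin 3)) :
    ‖h z‖ₑ ≤ eLpNorm h ∞ volume := by
  rw [eLpNorm_exponent_top]
  by_contra hlt
  have hlt' : eLpNormEssSup h volume < ‖h z‖ₑ := not_le.1 hlt
  set M := eLpNormEssSup h volume with hM
  have hO : IsOpen {w : EuclideanSpace ℝ (Fin 3) | M < ‖h w‖ₑ} :=
    isOpen_lt continuous_const hh.enorm
  have hpos : 0 < volume {w : EuclideanSpace ℝ (Fin 3) | M < ‖h w‖ₑ} :=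
    hO.measure_pos volume ⟨z, hlt'⟩
  have hae : ∀ᵐ w ∂(volume : Measure (EuclideanSpace ℝ (Fin 3))), ‖h w‖ₑ ≤ M :=
    enorm_ae_le_eLpNormEssSup h _
  rw [ae_iff] at hae
  simp only [not_le] at hae
  exact hpos.ne' hae

/-- **`‖P(G_σ(· - x₀)e)‖_{L²} ≤ C σ^{-3/4} ‖e‖`** with the constant `C` of the dispersive estimate
`‖e^{tΔ}v‖_{L^∞} ≤ C t^{-3/4}‖v‖_{L²}` (Tao 2011, §2; proof of Prop. 9.1, the force term of
(9.2): "`‖e^{(t-t')Δ} P f(t')‖_{L^∞} ≲ (t-t')^{-3/4}‖f(t')‖_{L²}`", by duality). Proof: pair the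
weakly divergence-free `L²` field `L = P(G_σ(· - x₀)e)` with itself,
`‖L‖₂² = ⟨e^{σΔ}L(x₀), e⟩` (`integral_inner_lerayHeatTest`), and `e^{σΔ}L = P(G_{2σ}(·-x₀)e)` is
continuous, so `|e^{σΔ}L(x₀)| ≤ ‖e^{σΔ}L‖_{L^∞} ≤ C σ^{-3/4}‖L‖₂`. [cite: Tao2011, Prop. 9.1 (proof, (9.2), force term) + §2 (dispersive inequality)] -/
theorem eLpNorm_lerayHeatTest_le {C : ℝ≥0}
    (hC : ∀ (v : EuclideanSpace ℝ (Fin 3) → EuclideanSpace ℝ (Fin 3)), MemLp v 2 volume →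
      ∀ t : ℝ, 0 < t → eLpNorm (heatExtension v t) ∞ volume ≤
        C * ENNReal.ofReal (t ^ (-(3 / 4 : ℝ))) * eLpNorm v 2 volume)
    (hσ : 0 < σ) :
    eLpNorm (lerayHeatTest x₀ σ e) 2 volume ≤ C * ENNReal.ofReal (σ ^ (-(3 / 4 : ℝ))) * ‖e‖ₑ := by
  set L := lerayHeatTest x₀ σ e with hL
  have hL2 : MemLp L 2 volume := memLp_two_lerayHeatTest hσ
  have hdiv : IsWeaklyDivFree L := isWeaklyDivFree_lerayHeatTest hσ
  -- `‖L‖₂² = ⟨e^{σΔ}L(x₀), e⟩`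
  have hpair : ∫ x, ⟪L x, L x⟫ = ⟪heatExtension L σ x₀, e⟫ := integral_inner_lerayHeatTest hσ hL2 hdiv
  have hsq : eLpNorm L 2 volume ^ 2 = ‖⟪heatExtension L σ x₀, e⟫‖ₑ := by
    rw [← hpair, enorm_integral_inner_self hL2]
  -- `e^{σΔ}L` is the (continuous) field `P(G_{2σ}(· - x₀)e)`
  have hext : heatExtension L σ = lerayHeatTest x₀ (σ + σ) e :=
    funext fun x => heatExtension_lerayHeatTest hσ hσ x
  have hcont : Continuous (heatExtension L σ) := by
    rw [hext]; exact (contDiff_lerayHeatTest (add_pos hσ hσ)).continuous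
  have hpt : ‖heatExtension L σ x₀‖ₑ ≤ C * ENNReal.ofReal (σ ^ (-(3 / 4 : ℝ))) * eLpNorm L 2 volume :=
    (enorm_apply_le_eLpNorm_top hcont x₀).trans (hC L hL2 σ hσ)
  have hinner : ‖⟪heatExtension L σ x₀, e⟫‖ₑ ≤ ‖heatExtension L σ x₀‖ₑ * ‖e‖ₑ := by
    rw [← ofReal_norm, ← ofReal_norm, ← ofReal_norm, ← ENNReal.ofReal_mul (norm_nonneg _)]
    exact ENNReal.ofReal_le_ofReal (norm_inner_le_norm _ _)
  set a := eLpNorm L 2 volume with ha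
  set K := C * ENNReal.ofReal (σ ^ (-(3 / 4 : ℝ))) * ‖e‖ₑ with hK
  have key : a * a ≤ K * a := by
    calc a * a = a ^ 2 := (sq a).symm
      _ = ‖⟪heatExtension L σ x₀, e⟫‖ₑ := hsq
      _ ≤ ‖heatExtension L σ x₀‖ₑ * ‖e‖ₑ := hinner
      _ ≤ (C * ENNReal.ofReal (σ ^ (-(3 / 4 : ℝ))) * a) * ‖e‖ₑ := mul_le_mul' hpt le_rfl
      _ = K * a := by rw [hK]; ring
  by_cases h0 : a = 0
  · simp [h0]
  · exact (ENNReal.mul_le_mul_iff_left h0 hL2.eLpNorm_ne_top).1 key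

end LerayHeatTestL2

/-! ## The `t`-integral of the heat symbol at viscosity `ν` -/

section HeatTime

variable {ν : ℝ}

/-- `∫_{(τ,∞)} e^{-(2π)²ν(t-τ)‖ξ‖²} dt = (ν(2π)²‖ξ‖²)⁻¹` for `ξ ≠ 0`, `ν > 0` (Tao 2011, proof of
Prop. 9.1, (9.7) "evaluating the `t` integral", at viscosity `ν`). [cite: Tao2011, Prop. 9.1 (proof, (9.7))] -/
theorem lintegral_Ioi_heatSymbol_mul_sub (hν : 0 < ν) {ξ : EuclideanSpace ℝ (Fin 3)} (hξ : ξ ≠ 0)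
    (τ : ℝ) :
    ∫⁻ t in Ioi τ, ENNReal.ofReal (heatSymbol (ν * (t - τ)) ξ) =
      ENNReal.ofReal ((ν * ((2 * π) ^ 2 * ‖ξ‖ ^ 2))⁻¹) := by
  rw [lintegral_Ioi_comp_sub (fun s => ENNReal.ofReal (heatSymbol (ν * s) ξ)) τ]
  have hb : 0 < ν * ((2 * π) ^ 2 * ‖ξ‖ ^ 2) := by
    have : 0 < ‖ξ‖ := norm_pos_iff.2 hξ
    positivity
  have ha : -(ν * ((2 * π) ^ 2 * ‖ξ‖ ^ 2)) < 0 := by linarith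
  have hfun : (fun s : ℝ => ENNReal.ofReal (heatSymbol (ν * s) ξ)) =
      fun s => ENNReal.ofReal (Real.exp (-(ν * ((2 * π) ^ 2 * ‖ξ‖ ^ 2)) * s)) := by
    funext s
    simp only [heatSymbol]
    congr 2
    ring
  rw [hfun, ← ofReal_integral_eq_lintegral_ofReal (integrableOn_exp_mul_Ioi ha 0)
    (Eventually.of_forall fun s => (Real.exp_pos _).le), integral_exp_mul_Ioi ha 0]
  congr 1
  rw [mul_zero, Real.exp_zero, neg_div_neg_eq, one_div]

/-- **The `t`-integral of the heat symbol at viscosity `ν`, weighted**: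
`‖ξ‖ ∫_{(τ,∞)} e^{-(2π)²ν(t-τ)‖ξ‖²} dt ≤ (ν(2π)²)⁻¹ ‖ξ‖⁻¹`. [cite: Tao2011, Prop. 9.1 (proof, (9.7))] -/
theorem enorm_mul_lintegral_Ioi_heatSymbol_mul_le (hν : 0 < ν) (ξ : EuclideanSpace ℝ (Fin 3))
    (τ : ℝ) :
    ‖ξ‖ₑ * ∫⁻ t in Ioi τ, ENNReal.ofReal (heatSymbol (ν * (t - τ)) ξ) ≤
      ENNReal.ofReal ((ν * (2 * π) ^ 2)⁻¹) * ‖ξ‖ₑ⁻¹ := by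
  by_cases hξ : ξ = 0
  · subst hξ
    simp
  · rw [lintegral_Ioi_heatSymbol_mul_sub hν hξ τ]
    have hn : 0 < ‖ξ‖ := norm_pos_iff.2 hξ
    rw [← ofReal_norm, ← ENNReal.ofReal_inv_of_pos hn, ← ENNReal.ofReal_mul (norm_nonneg _),
      ← ENNReal.ofReal_mul (by positivity)]
    refine ENNReal.ofReal_le_ofReal (le_of_eq ?_)
    field_simp

/-- **Step 2 of the time integration at viscosity `ν`, one frequency function**: for measurable
`Φ ≥ 0`, `∫_{(τ,∞)} ∫ ‖ξ‖ e^{-4π²ν(t-τ)‖ξ‖²} Φ(ξ) dξ dt ≤ (ν(2π)²)⁻¹ ∫ ‖ξ‖⁻¹ Φ(ξ) dξ`.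
[cite: Tao2011, Prop. 9.1 (proof, (9.7))] -/
theorem lintegral_Ioi_lintegral_heatSymbol_visc_mul_le (hν : 0 < ν)
    {Φ : EuclideanSpace ℝ (Fin 3) → ℝ≥0∞} (hΦ : Measurable Φ) (τ : ℝ) :
    ∫⁻ t in Ioi τ, ∫⁻ ξ, ‖ξ‖ₑ * ENNReal.ofReal (heatSymbol (ν * (t - τ)) ξ) * Φ ξ ≤
      ENNReal.ofReal ((ν * (2 * π) ^ 2)⁻¹) * ∫⁻ ξ, ‖ξ‖ₑ⁻¹ * Φ ξ := by
  have hhs : Measurable fun q : ℝ × EuclideanSpace ℝ (Fin 3) =>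
      ENNReal.ofReal (heatSymbol (ν * (q.1 - τ)) q.2) := by
    refine ENNReal.measurable_ofReal.comp (Continuous.measurable ?_)
    simp only [heatSymbol]
    fun_prop
  have hm : Measurable fun q : ℝ × EuclideanSpace ℝ (Fin 3) =>
      ‖q.2‖ₑ * ENNReal.ofReal (heatSymbol (ν * (q.1 - τ)) q.2) * Φ q.2 :=
    (measurable_snd.enorm.mul hhs).mul (hΦ.comp measurable_snd)
  calc ∫⁻ t in Ioi τ, ∫⁻ ξ, ‖ξ‖ₑ * ENNReal.ofReal (heatSymbol (ν * (t - τ)) ξ) * Φ ξ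
      = ∫⁻ ξ, ∫⁻ t in Ioi τ, ‖ξ‖ₑ * ENNReal.ofReal (heatSymbol (ν * (t - τ)) ξ) * Φ ξ :=
        lintegral_lintegral_swap hm.aemeasurable
    _ ≤ ∫⁻ ξ, ENNReal.ofReal ((ν * (2 * π) ^ 2)⁻¹) * (‖ξ‖ₑ⁻¹ * Φ ξ) := by
        refine lintegral_mono fun ξ => ?_
        have hmt : Measurable fun t : ℝ => ENNReal.ofReal (heatSymbol (ν * (t - τ)) ξ) :=
          hhs.comp (measurable_id.prodMk measurable_const)
        calc ∫⁻ t in Ioi τ, ‖ξ‖ₑ * ENNReal.ofReal (heatSymbol (ν * (t - τ)) ξ) * Φ ξ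
            = ∫⁻ t in Ioi τ, (‖ξ‖ₑ * Φ ξ) * ENNReal.ofReal (heatSymbol (ν * (t - τ)) ξ) :=
              lintegral_congr fun t => by ring
          _ = (‖ξ‖ₑ * Φ ξ) * ∫⁻ t in Ioi τ, ENNReal.ofReal (heatSymbol (ν * (t - τ)) ξ) :=
              lintegral_const_mul _ hmt
          _ = Φ ξ * (‖ξ‖ₑ * ∫⁻ t in Ioi τ, ENNReal.ofReal (heatSymbol (ν * (t - τ)) ξ)) := by ring
          _ ≤ Φ ξ * (ENNReal.ofReal ((ν * (2 * π) ^ 2)⁻¹) * ‖ξ‖ₑ⁻¹) :=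
              mul_le_mul' le_rfl (enorm_mul_lintegral_Ioi_heatSymbol_mul_le hν ξ τ)
          _ = ENNReal.ofReal ((ν * (2 * π) ^ 2)⁻¹) * (‖ξ‖ₑ⁻¹ * Φ ξ) := by ring
    _ = ENNReal.ofReal ((ν * (2 * π) ^ 2)⁻¹) * ∫⁻ ξ, ‖ξ‖ₑ⁻¹ * Φ ξ :=
        lintegral_const_mul' _ _ ENNReal.ofReal_ne_top

/-- **Step 2 at viscosity `ν`, summed over the components.** [cite: Tao2011, Prop. 9.1 (proof, (9.7))] -/
theorem lintegral_Ioi_sum_sum_lintegral_heatSymbol_visc_mul_le (hν : 0 < ν)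
    {Φ : Fin 3 → Fin 3 → EuclideanSpace ℝ (Fin 3) → ℝ≥0∞} (hΦ : ∀ j k, Measurable (Φ j k)) (τ : ℝ) :
    ∫⁻ t in Ioi τ, ∑ j, ∑ k, ∫⁻ ξ, ‖ξ‖ₑ * ENNReal.ofReal (heatSymbol (ν * (t - τ)) ξ) * Φ j k ξ ≤
      ENNReal.ofReal ((ν * (2 * π) ^ 2)⁻¹) * ∑ j, ∑ k, ∫⁻ ξ, ‖ξ‖ₑ⁻¹ * Φ j k ξ := by
  have hm : ∀ j k, Measurable fun t : ℝ =>
      ∫⁻ ξ, ‖ξ‖ₑ * ENNReal.ofReal (heatSymbol (ν * (t - τ)) ξ) * Φ j k ξ := by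
    intro j k
    have hhs : Measurable fun q : ℝ × EuclideanSpace ℝ (Fin 3) =>
        ENNReal.ofReal (heatSymbol (ν * (q.1 - τ)) q.2) := by
      refine ENNReal.measurable_ofReal.comp (Continuous.measurable ?_)
      simp only [heatSymbol]
      fun_prop
    exact ((measurable_snd.enorm.mul hhs).mul ((hΦ j k).comp measurable_snd)).lintegral_prod_right'
  rw [lintegral_finsetSum _ fun j _ => Finset.measurable_sum _ fun k _ => hm j k, Finset.mul_sum]
  refine Finset.sum_le_sum fun j _ => ?_
  rw [lintegral_finsetSum _ fun k _ => hm j k, Finset.mul_sum]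
  exact Finset.sum_le_sum fun k _ => lintegral_Ioi_lintegral_heatSymbol_visc_mul_le hν (hΦ j k) τ

/-- Measurability of the `(t, τ, ξ)`-integrand of the majorant at viscosity `ν`. [folklore] -/
private theorem measurable_speedMajorant_integrand_visc (ν : ℝ)
    {U : ℝ → EuclideanSpace ℝ (Fin 3) → EuclideanSpace ℝ (Fin 3)} (hU : Continuous (uncurry U))
    (j k : Fin 3) :
    Measurable fun q : (ℝ × ℝ) × EuclideanSpace ℝ (Fin 3) =>
      ‖q.2‖ₑ * ENNReal.ofReal (heatSymbol (ν * (q.1.1 - q.1.2)) q.2) *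
        ‖𝓕 (fun x => ((U q.1.2 x j * U q.1.2 x k : ℝ) : ℂ)) q.2‖ₑ := by
  have h1 : Measurable fun q : (ℝ × ℝ) × EuclideanSpace ℝ (Fin 3) => ‖q.2‖ₑ := measurable_snd.enorm
  have h2 : Measurable fun q : (ℝ × ℝ) × EuclideanSpace ℝ (Fin 3) =>
      ENNReal.ofReal (heatSymbol (ν * (q.1.1 - q.1.2)) q.2) := by
    refine ENNReal.measurable_ofReal.comp (Continuous.measurable ?_)
    simp only [heatSymbol]
    fun_prop
  have h3 : Measurable fun q : (ℝ × ℝ) × EuclideanSpace ℝ (Fin 3) =>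
      ‖𝓕 (fun x => ((U q.1.2 x j * U q.1.2 x k : ℝ) : ℂ)) q.2‖ₑ :=
    ((measurable_fourier_comp_mul_comp hU j k).comp
      ((measurable_snd.comp measurable_fst).prodMk measurable_snd)).enorm
  exact (h1.mul h2).mul h3

/-- **`∫₀ᵀ M_ν(t) dt ≤ (6S/(ν(2π)⁴)) ∫₀ᵀ ∫ |∇U|²_F`** — the time integral of the Fourier majorant
`M_ν(t) = ∫_{0<τ<t} ∑ⱼₖ ∫ ‖ξ‖ e^{-4π²ν(t-τ)‖ξ‖²} |𝓕(UⱼUₖ)(τ,ξ)| dξ dτ` at viscosity `ν`, for a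
jointly continuous field `U` with smooth `L²` slices on `(0, T)`; `S = schurConst` (Tao 2011,
proof of Prop. 9.1, (9.7) and Schur's test). [cite: Tao2011, Prop. 9.1 (proof, (9.7) and Schur's test)] -/
theorem lintegral_lintegral_speedMajorant_visc_le (hν : 0 < ν)
    {U : ℝ → EuclideanSpace ℝ (Fin 3) → EuclideanSpace ℝ (Fin 3)} (hUc : Continuous (uncurry U))
    {T : ℝ} (hUs : ∀ τ ∈ Ioo 0 T, ContDiff ℝ ∞ (U τ))
    (hU2 : ∀ τ ∈ Ioo 0 T, MemLp (U τ) 2 volume) :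
    ∫⁻ t in Ioo 0 T, ∫⁻ τ in Ioo 0 t, ∑ j, ∑ k,
        ∫⁻ ξ, ‖ξ‖ₑ * ENNReal.ofReal (heatSymbol (ν * (t - τ)) ξ) *
          ‖𝓕 (fun x => ((U τ x j * U τ x k : ℝ) : ℂ)) ξ‖ₑ ≤
      ENNReal.ofReal (6 * schurConst / (ν * (2 * π) ^ 4)) *
        ∫⁻ τ in Ioo 0 T, ∫⁻ x, ENNReal.ofReal (frobeniusNormSq (fderiv ℝ (U τ) x)) := by
  have hF : ∀ j k, Measurable fun p : ℝ × EuclideanSpace ℝ (Fin 3) =>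
      𝓕 (fun x => ((U p.1 x j * U p.1 x k : ℝ) : ℂ)) p.2 :=
    fun j k => measurable_fourier_comp_mul_comp hUc j k
  have hfm : Measurable (uncurry fun t τ : ℝ => ∑ j, ∑ k,
      ∫⁻ ξ, ‖ξ‖ₑ * ENNReal.ofReal (heatSymbol (ν * (t - τ)) ξ) *
        ‖𝓕 (fun x => ((U τ x j * U τ x k : ℝ) : ℂ)) ξ‖ₑ) := by
    change Measurable fun p : ℝ × ℝ => ∑ j, ∑ k,
      ∫⁻ ξ, ‖ξ‖ₑ * ENNReal.ofReal (heatSymbol (ν * (p.1 - p.2)) ξ) *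
        ‖𝓕 (fun x => ((U p.2 x j * U p.2 x k : ℝ) : ℂ)) ξ‖ₑ
    refine Finset.measurable_sum _ fun j _ => Finset.measurable_sum _ fun k _ => ?_
    exact (measurable_speedMajorant_integrand_visc ν hUc j k).lintegral_prod_right'
  set c₁ : ℝ≥0∞ := ENNReal.ofReal ((ν * (2 * π) ^ 2)⁻¹) with hc₁
  set c₂ : ℝ≥0∞ := ENNReal.ofReal (6 * (schurConst / (2 * π) ^ 2)) with hc₂
  have hconst : c₁ * c₂ = ENNReal.ofReal (6 * schurConst / (ν * (2 * π) ^ 4)) := by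
    rw [hc₁, hc₂, ← ENNReal.ofReal_mul (by positivity)]
    congr 1
    field_simp
  calc ∫⁻ t in Ioo 0 T, ∫⁻ τ in Ioo 0 t, ∑ j, ∑ k,
        ∫⁻ ξ, ‖ξ‖ₑ * ENNReal.ofReal (heatSymbol (ν * (t - τ)) ξ) *
          ‖𝓕 (fun x => ((U τ x j * U τ x k : ℝ) : ℂ)) ξ‖ₑ
      ≤ ∫⁻ τ in Ioo 0 T, ∫⁻ t in Ioi τ, ∑ j, ∑ k,
          ∫⁻ ξ, ‖ξ‖ₑ * ENNReal.ofReal (heatSymbol (ν * (t - τ)) ξ) *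
            ‖𝓕 (fun x => ((U τ x j * U τ x k : ℝ) : ℂ)) ξ‖ₑ :=
        lintegral_Ioo_lintegral_Ioo_le_swap hfm T
    _ ≤ ∫⁻ τ in Ioo 0 T, c₁ * ∑ j, ∑ k,
          ∫⁻ ξ, ‖ξ‖ₑ⁻¹ * ‖𝓕 (fun x => ((U τ x j * U τ x k : ℝ) : ℂ)) ξ‖ₑ := by
        refine lintegral_mono fun τ => ?_
        exact lintegral_Ioi_sum_sum_lintegral_heatSymbol_visc_mul_le hν
          (Φ := fun j k ξ => ‖𝓕 (fun x => ((U τ x j * U τ x k : ℝ) : ℂ)) ξ‖ₑ)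
          (fun j k => ((hF j k).comp (measurable_const.prodMk measurable_id)).enorm) τ
    _ ≤ ∫⁻ τ in Ioo 0 T, c₁ * (c₂ * ∫⁻ x, ENNReal.ofReal (frobeniusNormSq (fderiv ℝ (U τ) x))) := by
        refine setLIntegral_mono' measurableSet_Ioo fun τ hτ => ?_
        exact mul_le_mul' le_rfl (sum_sum_lintegral_inv_norm_fourier_mul_le (hUs τ hτ) (hU2 τ hτ))
    _ = ENNReal.ofReal (6 * schurConst / (ν * (2 * π) ^ 4)) *
          ∫⁻ τ in Ioo 0 T, ∫⁻ x, ENNReal.ofReal (frobeniusNormSq (fderiv ℝ (U τ) x)) := by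
        rw [← hconst, mul_assoc, ← lintegral_const_mul' _ _ ENNReal.ofReal_ne_top,
          ← lintegral_const_mul' _ _ ENNReal.ofReal_ne_top]

end HeatTime

/-! ## The pointwise Duhamel bound WITH force -/

section Pointwise

variable {T ν : ℝ} {f u : ℝ → EuclideanSpace ℝ (Fin 3) → EuclideanSpace ℝ (Fin 3)}
  {p : ℝ → EuclideanSpace ℝ (Fin 3) → ℝ}

/-- `‖v‖_{L²} ≤ A^{1/2}` from `∫ |v|² ≤ A`. [folklore] -/
private theorem eLpNorm_two_le_rpow_half_of_lintegral_sq_le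
    {v : EuclideanSpace ℝ (Fin 3) → EuclideanSpace ℝ (Fin 3)} {A : ℝ≥0∞}
    (h : ∫⁻ x, ‖v x‖ₑ ^ 2 ≤ A) : eLpNorm v 2 volume ≤ A ^ (1 / 2 : ℝ) := by
  have h2 : eLpNorm v 2 volume ^ 2 ≤ A := by
    rw [eLpNorm_two_sq_eq_lintegral]; exact h
  calc eLpNorm v 2 volume = (eLpNorm v 2 volume ^ 2) ^ (1 / 2 : ℝ) := by
        rw [← ENNReal.rpow_natCast, ← ENNReal.rpow_mul]; norm_num
    _ ≤ A ^ (1 / 2 : ℝ) := ENNReal.rpow_le_rpow h2 (by norm_num)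

/-- **The regularised Duhamel formula WITH force against a direction, bounded by the majorants**
(Tao 2011, proof of Prop. 9.1: (9.2) tested against `φ = P(G_ε(·−x₀)e)`, the nonlinear term by
the display before (9.7), the force term by the dispersive bound
`‖e^{(t-t')νΔ}Pf(t')‖_{L^∞} ≲ (ν(t-t'))^{-3/4}‖f(t')‖_{L²}`). For a Leray–Hopf solution `u` of the
forced system (viscosity `ν > 0`, force `f ∈ L²_{t,x}`) on `[0,T)` with `sup_t ∫|u(t)|² < ∞`,
`t ∈ (0, T]`, `x₀`, `e` and `0 < ε`:
`|⟪(e^{εΔ}u(t))(x₀), e⟫ − ⟪(e^{(ε+νt)Δ}u(0))(x₀), e⟫| ≤ ‖e‖ (2π M_ν(t) + C F_ν(t))` in `ℝ≥0∞`,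
with the Fourier majorant `M_ν(t) = ∫_{0<τ<t} ∑ⱼₖ ∫ ‖ξ‖ e^{-4π²ν(t-τ)‖ξ‖²} |𝓕(uⱼuₖ)(τ,ξ)| dξ dτ`
and the force majorant `F_ν(t) = ∫_{0<τ<t} (ν(t-τ))^{-3/4} ‖f(τ)‖_{L²} dτ` (`C` the dispersive
constant). [cite: Tao2011, Prop. 9.1 (proof, (9.2) and display before (9.7))] -/
theorem enorm_inner_heatExtension_sub_le_speedMajorant_forced (hν : 0 < ν) (hT : 0 < T)
    (hLH : IsLerayHopfOn T ν f (u 0) u)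
    (hfm : AEStronglyMeasurable (uncurry f)
      ((volume.restrict (Ioo 0 T)).prod (volume : Measure (EuclideanSpace ℝ (Fin 3)))))
    (hf2 : eLpNorm (uncurry f) 2
      ((volume.restrict (Ioo 0 T)).prod (volume : Measure (EuclideanSpace ℝ (Fin 3)))) < ⊤)
    (hfe : ∃ A : ℝ≥0∞, A < ⊤ ∧ ∀ t ∈ Icc 0 T, ∫⁻ x, ‖u t x‖ₑ ^ 2 ≤ A)
    {C : ℝ≥0}
    (hC : ∀ (v : EuclideanSpace ℝ (Fin 3) → EuclideanSpace ℝ (Fin 3)), MemLp v 2 volume →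
      ∀ t : ℝ, 0 < t → eLpNorm (heatExtension v t) ∞ volume ≤
        C * ENNReal.ofReal (t ^ (-(3 / 4 : ℝ))) * eLpNorm v 2 volume)
    {t : ℝ} (ht : t ∈ Ioc 0 T) (x₀ e : EuclideanSpace ℝ (Fin 3)) {ε : ℝ} (hε : 0 < ε) :
    ‖⟪heatExtension (u t) ε x₀, e⟫ - ⟪heatExtension (u 0) (ε + ν * t) x₀, e⟫‖ₑ ≤
      ‖e‖ₑ * (ENNReal.ofReal (2 * π) * (∫⁻ τ in Ioo 0 t, ∑ j, ∑ k,
          ∫⁻ ξ, ‖ξ‖ₑ * ENNReal.ofReal (heatSymbol (ν * (t - τ)) ξ) *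
            ‖𝓕 (fun x => ((u τ x j * u τ x k : ℝ) : ℂ)) ξ‖ₑ) +
        C * ∫⁻ τ in Ioo 0 t, ENNReal.ofReal ((ν * (t - τ)) ^ (-(3 / 4 : ℝ))) *
          eLpNorm (f τ) 2 volume) := by
  obtain ⟨A, hAtop, hA⟩ := hfe
  have hL2 : ∀ s ∈ Icc 0 T, MemLp (u s) 2 volume := hLH.memLp
  have h0T : (0 : ℝ) ∈ Icc 0 T := ⟨le_rfl, hT.le⟩
  have htT : t ∈ Icc 0 T := ⟨ht.1.le, ht.2⟩
  have hνt : 0 < ν * t := mul_pos hν ht.1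
  have hdivt : IsWeaklyDivFree (u t) := hLH.isWeaklyDivFree_slice ht
  have hdiv0 : IsWeaklyDivFree (u 0) := hLH.isWeaklyDivFree_datum hT
  have hM : ∀ s ∈ Icc 0 T, eLpNorm (u s) 2 volume ≤ A ^ (1 / 2 : ℝ) := fun s hs =>
    eLpNorm_two_le_rpow_half_of_lintegral_sq_le (hA s hs)
  have hMtop : A ^ (1 / 2 : ℝ) ≠ ⊤ := ENNReal.rpow_ne_top_of_nonneg (by norm_num) hAtop.ne
  -- the duality identity WITH force, `φ = P(G_ε(· - x₀) e)`
  have hid := hLH.integral_inner_eq_mild_of_hasWeakGradient_forced finrank_euclideanSpace_fin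
    (hL2 0 h0T) hν hT hfm hf2 hMtop hM (memLp_two_lerayHeatTest (x₀ := x₀) (e := e) hε)
    (isWeaklyDivFree_lerayHeatTest hε) (hasWeakGradient_lerayHeatTest hε)
    (lintegral_frobeniusNormSq_fderiv_lerayHeatTest_lt_top hε) ht
  -- the caloric test field at elapsed time `ν s`
  have hfun : ∀ {s : ℝ}, 0 < s →
      heatTest ν (lerayHeatTest x₀ ε e) s = lerayHeatTest x₀ (ε + ν * s) e := by
    intro s hs
    rw [heatTest_of_pos hν hs]
    funext x
    exact heatExtension_lerayHeatTest hε (mul_pos hν hs) x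
  -- the two linear terms
  have hlhs : ∫ x, ⟪u t x, lerayHeatTest x₀ ε e x⟫ = ⟪heatExtension (u t) ε x₀, e⟫ :=
    integral_inner_lerayHeatTest hε (hL2 t htT) hdivt
  have hfree : ∫ x, ⟪u 0 x, heatTest ν (lerayHeatTest x₀ ε e) t x⟫ =
      ⟪heatExtension (u 0) (ε + ν * t) x₀, e⟫ := by
    rw [hfun ht.1]
    exact integral_inner_lerayHeatTest (add_pos hε hνt) (hL2 0 h0T) hdiv0
  -- the nonlinear term, pointwise in `τ ∈ (0, t)` and integrated
  set c : ℝ → ℝ := fun τ =>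
    ∫ x, ⟪u τ x, convect (u τ) (heatTest ν (lerayHeatTest x₀ ε e) (t - τ)) x⟫ with hc
  have hcτ : ∀ τ ∈ Ioo 0 t, ‖c τ‖ₑ ≤ ENNReal.ofReal (2 * π * ‖e‖) * ∑ j, ∑ k,
      ∫⁻ ξ, ‖ξ‖ₑ * ENNReal.ofReal (heatSymbol (ν * (t - τ)) ξ) *
        ‖𝓕 (fun x => ((u τ x j * u τ x k : ℝ) : ℂ)) ξ‖ₑ := by
    intro τ hτ
    have hs : 0 < ν * (t - τ) := mul_pos hν (sub_pos.2 hτ.2)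
    simp only [hc, hfun (sub_pos.2 hτ.2)]
    exact enorm_integral_inner_convect_lerayHeatTest_le hε.le hs
      (hL2 τ ⟨hτ.1.le, (hτ.2.trans_le ht.2).le⟩)
  have hNL : ‖∫ τ in Ioc 0 t, c τ‖ₑ ≤ ENNReal.ofReal (2 * π * ‖e‖) * ∫⁻ τ in Ioo 0 t, ∑ j, ∑ k,
      ∫⁻ ξ, ‖ξ‖ₑ * ENNReal.ofReal (heatSymbol (ν * (t - τ)) ξ) *
        ‖𝓕 (fun x => ((u τ x j * u τ x k : ℝ) : ℂ)) ξ‖ₑ := by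
    calc ‖∫ τ in Ioc 0 t, c τ‖ₑ ≤ ∫⁻ τ in Ioc 0 t, ‖c τ‖ₑ := enorm_integral_le_lintegral_enorm _
      _ = ∫⁻ τ in Ioo 0 t, ‖c τ‖ₑ := setLIntegral_congr Ioo_ae_eq_Ioc.symm
      _ ≤ ∫⁻ τ in Ioo 0 t, ENNReal.ofReal (2 * π * ‖e‖) * ∑ j, ∑ k,
            ∫⁻ ξ, ‖ξ‖ₑ * ENNReal.ofReal (heatSymbol (ν * (t - τ)) ξ) *
              ‖𝓕 (fun x => ((u τ x j * u τ x k : ℝ) : ℂ)) ξ‖ₑ :=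
          setLIntegral_mono' measurableSet_Ioo hcτ
      _ = _ := lintegral_const_mul' _ _ ENNReal.ofReal_ne_top
  -- the force term, pointwise in a.e. `τ ∈ (0, t)` and integrated
  set d : ℝ → ℝ := fun τ => ∫ x, ⟪f τ x, heatTest ν (lerayHeatTest x₀ ε e) (t - τ) x⟫ with hd
  have hfsl : ∀ᵐ τ ∂(volume.restrict (Ioo 0 t)), MemLp (f τ) 2 volume :=
    ae_mono (Measure.restrict_mono (Ioo_subset_Ioo le_rfl ht.2) le_rfl)
      (ae_memLp_two_slice_of_eLpNorm_prod hfm hf2)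
  have hdτ : ∀ᵐ τ ∂(volume.restrict (Ioo 0 t)), ‖d τ‖ₑ ≤ (C * ‖e‖ₑ) *
      (ENNReal.ofReal ((ν * (t - τ)) ^ (-(3 / 4 : ℝ))) * eLpNorm (f τ) 2 volume) := by
    filter_upwards [hfsl, ae_restrict_mem measurableSet_Ioo] with τ hfτ hτ
    have hs : 0 < ν * (t - τ) := mul_pos hν (sub_pos.2 hτ.2)
    simp only [hd, hfun (sub_pos.2 hτ.2)]
    calc ‖∫ x, ⟪f τ x, lerayHeatTest x₀ (ε + ν * (t - τ)) e x⟫‖ₑ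
        ≤ eLpNorm (f τ) 2 volume * eLpNorm (lerayHeatTest x₀ (ε + ν * (t - τ)) e) 2 volume :=
          FunctionSpaces.enorm_integral_inner_le_eLpNorm_mul hfτ.1
            (memLp_two_lerayHeatTest (add_pos hε hs)).1
      _ ≤ eLpNorm (f τ) 2 volume *
            (C * ENNReal.ofReal ((ε + ν * (t - τ)) ^ (-(3 / 4 : ℝ))) * ‖e‖ₑ) :=
          mul_le_mul' le_rfl (eLpNorm_lerayHeatTest_le hC (add_pos hε hs))
      _ ≤ eLpNorm (f τ) 2 volume * (C * ENNReal.ofReal ((ν * (t - τ)) ^ (-(3 / 4 : ℝ))) * ‖e‖ₑ) := by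
          refine mul_le_mul' le_rfl (mul_le_mul' (mul_le_mul' le_rfl ?_) le_rfl)
          exact ENNReal.ofReal_le_ofReal
            (Real.rpow_le_rpow_of_nonpos hs (by linarith) (by norm_num))
      _ = (C * ‖e‖ₑ) * (ENNReal.ofReal ((ν * (t - τ)) ^ (-(3 / 4 : ℝ))) * eLpNorm (f τ) 2 volume) := by
          ring
  have hF : ‖∫ τ in Ioc 0 t, d τ‖ₑ ≤ (C * ‖e‖ₑ) *
      ∫⁻ τ in Ioo 0 t, ENNReal.ofReal ((ν * (t - τ)) ^ (-(3 / 4 : ℝ))) * eLpNorm (f τ) 2 volume := by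
    calc ‖∫ τ in Ioc 0 t, d τ‖ₑ ≤ ∫⁻ τ in Ioc 0 t, ‖d τ‖ₑ := enorm_integral_le_lintegral_enorm _
      _ = ∫⁻ τ in Ioo 0 t, ‖d τ‖ₑ := setLIntegral_congr Ioo_ae_eq_Ioc.symm
      _ ≤ ∫⁻ τ in Ioo 0 t, (C * ‖e‖ₑ) *
            (ENNReal.ofReal ((ν * (t - τ)) ^ (-(3 / 4 : ℝ))) * eLpNorm (f τ) 2 volume) :=
          lintegral_mono_ae hdτ
      _ = _ := lintegral_const_mul' _ _ (ENNReal.mul_ne_top ENNReal.coe_ne_top enorm_ne_top)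
  -- assemble
  have hkey : ⟪heatExtension (u t) ε x₀, e⟫ - ⟪heatExtension (u 0) (ε + ν * t) x₀, e⟫ =
      (∫ τ in Ioc 0 t, c τ) + ∫ τ in Ioc 0 t, d τ := by
    rw [← hlhs, ← hfree, hid]
    ring
  rw [hkey]
  calc ‖(∫ τ in Ioc 0 t, c τ) + ∫ τ in Ioc 0 t, d τ‖ₑ
      ≤ ‖∫ τ in Ioc 0 t, c τ‖ₑ + ‖∫ τ in Ioc 0 t, d τ‖ₑ := enorm_add_le _ _
    _ ≤ _ := add_le_add hNL hF
    _ = _ := by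
        rw [ENNReal.ofReal_mul (by positivity : (0 : ℝ) ≤ 2 * π), ofReal_norm]
        ring

/-- **The Duhamel formula WITH force: `u(t) − e^{νtΔ}u(0)` is dominated pointwise by the
majorants** (Tao 2011, proof of Prop. 9.1, (9.2)–(9.7) with the force term). For a classical
solution `(u, p)` of the forced Navier–Stokes system (viscosity `ν > 0`, force `f ∈ L²_{t,x}`) on
the closed slab `[0, T] × ℝ³` which is a Leray–Hopf solution from `u(0)` with finite energy
`sup_t ∫|u(t)|² < ∞`, every `t ∈ (0, T]` and every `x₀`:
`‖u(t, x₀) − (e^{νtΔ}u(0))(x₀)‖ ≤ 2π M_ν(t) + C F_ν(t)` in `ℝ≥0∞` (majorants as in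
`enorm_inner_heatExtension_sub_le_speedMajorant_forced`; `ε → 0⁺` in the regularised bound).
[cite: Tao2011, Prop. 9.1 (proof, (9.2)–(9.7))] -/
theorem enorm_sub_heatExtension_le_speedMajorant_forced (hν : 0 < ν) (hT : 0 < T)
    (hsol : IsClassicalNSSolutionOn (Icc 0 T) ν f u p) (hLH : IsLerayHopfOn T ν f (u 0) u)
    (hfm : AEStronglyMeasurable (uncurry f)
      ((volume.restrict (Ioo 0 T)).prod (volume : Measure (EuclideanSpace ℝ (Fin 3)))))
    (hf2 : eLpNorm (uncurry f) 2
      ((volume.restrict (Ioo 0 T)).prod (volume : Measure (EuclideanSpace ℝ (Fin 3)))) < ⊤)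
    (hfe : ∃ A : ℝ≥0∞, A < ⊤ ∧ ∀ t ∈ Icc 0 T, ∫⁻ x, ‖u t x‖ₑ ^ 2 ≤ A)
    {C : ℝ≥0}
    (hC : ∀ (v : EuclideanSpace ℝ (Fin 3) → EuclideanSpace ℝ (Fin 3)), MemLp v 2 volume →
      ∀ t : ℝ, 0 < t → eLpNorm (heatExtension v t) ∞ volume ≤
        C * ENNReal.ofReal (t ^ (-(3 / 4 : ℝ))) * eLpNorm v 2 volume)
    {t : ℝ} (ht : t ∈ Ioc 0 T) (x₀ : EuclideanSpace ℝ (Fin 3)) :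
    ‖u t x₀ - heatExtension (u 0) (ν * t) x₀‖ₑ ≤
      ENNReal.ofReal (2 * π) * (∫⁻ τ in Ioo 0 t, ∑ j, ∑ k,
          ∫⁻ ξ, ‖ξ‖ₑ * ENNReal.ofReal (heatSymbol (ν * (t - τ)) ξ) *
            ‖𝓕 (fun x => ((u τ x j * u τ x k : ℝ) : ℂ)) ξ‖ₑ) +
        C * ∫⁻ τ in Ioo 0 t, ENNReal.ofReal ((ν * (t - τ)) ^ (-(3 / 4 : ℝ))) *
          eLpNorm (f τ) 2 volume := by
  set B : ℝ≥0∞ := ENNReal.ofReal (2 * π) * (∫⁻ τ in Ioo 0 t, ∑ j, ∑ k,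
          ∫⁻ ξ, ‖ξ‖ₑ * ENNReal.ofReal (heatSymbol (ν * (t - τ)) ξ) *
            ‖𝓕 (fun x => ((u τ x j * u τ x k : ℝ) : ℂ)) ξ‖ₑ) +
        C * ∫⁻ τ in Ioo 0 t, ENNReal.ofReal ((ν * (t - τ)) ^ (-(3 / 4 : ℝ))) *
          eLpNorm (f τ) 2 volume with hB
  rcases eq_or_lt_of_le (le_top : B ≤ ⊤) with hBtop | hBtop
  · rw [hBtop]; exact le_top
  have hL2 : ∀ s ∈ Icc 0 T, MemLp (u s) 2 volume := hLH.memLp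
  have h0T : (0 : ℝ) ∈ Icc 0 T := ⟨le_rfl, hT.le⟩
  have htT : t ∈ Icc 0 T := ⟨ht.1.le, ht.2⟩
  have hνt : 0 < ν * t := mul_pos hν ht.1
  set w : EuclideanSpace ℝ (Fin 3) := u t x₀ - heatExtension (u 0) (ν * t) x₀ with hw
  -- the regularised bound, in real form
  have hreg : ∀ e : EuclideanSpace ℝ (Fin 3), ∀ ε : ℝ, 0 < ε →
      |⟪heatExtension (u t) ε x₀, e⟫ - ⟪heatExtension (u 0) (ε + ν * t) x₀, e⟫| ≤
        ‖e‖ * B.toReal := by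
    intro e ε hε
    have h := enorm_inner_heatExtension_sub_le_speedMajorant_forced hν hT hLH hfm hf2 hfe hC ht x₀ e hε
    rw [← hB] at h
    have h2 : ‖⟪heatExtension (u t) ε x₀, e⟫ - ⟪heatExtension (u 0) (ε + ν * t) x₀, e⟫‖ₑ ≤
        ENNReal.ofReal (‖e‖ * B.toReal) := by
      rwa [ENNReal.ofReal_mul (norm_nonneg _), ofReal_norm, ENNReal.ofReal_toReal hBtop.ne]
    rw [← ofReal_norm, ENNReal.ofReal_le_ofReal_iff (by positivity), Real.norm_eq_abs] at h2
    exact h2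
  -- `ε → 0⁺`
  have hlim1 : Tendsto (fun ε : ℝ => heatExtension (u t) ε x₀) (𝓝[>] 0) (𝓝 (u t x₀)) :=
    tendsto_heatExtension_nhdsGT_zero_of_continuousAt (hL2 t htT) one_le_two
      (hsol.contDiff_velocity htT).continuous.continuousAt
  have hlim2 : Tendsto (fun ε : ℝ => heatExtension (u 0) (ε + ν * t) x₀) (𝓝[>] 0)
      (𝓝 (heatExtension (u 0) (ν * t) x₀)) := by
    have hcont : ContinuousAt (fun σ : ℝ => heatExtension (u 0) σ x₀) (ν * t) :=
      (continuousOn_heatExtension_time (hL2 0 h0T) one_le_two x₀).continuousAt (Ioi_mem_nhds hνt)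
    have hadd : Tendsto (fun ε : ℝ => ε + ν * t) (𝓝[>] 0) (𝓝 (ν * t)) := by
      have h : Tendsto (fun ε : ℝ => ε + ν * t) (𝓝 0) (𝓝 (0 + ν * t)) :=
        (continuous_id.add continuous_const).tendsto 0
      rw [zero_add] at h
      exact h.mono_left nhdsWithin_le_nhds
    exact hcont.tendsto.comp hadd
  have hbound : ∀ e : EuclideanSpace ℝ (Fin 3), |⟪w, e⟫| ≤ ‖e‖ * B.toReal := by
    intro e
    have hT' : Tendsto (fun ε : ℝ => |⟪heatExtension (u t) ε x₀, e⟫ -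
        ⟪heatExtension (u 0) (ε + ν * t) x₀, e⟫|) (𝓝[>] 0) (𝓝 |⟪w, e⟫|) := by
      have h : Tendsto (fun ε : ℝ => |⟪heatExtension (u t) ε x₀, e⟫ -
          ⟪heatExtension (u 0) (ε + ν * t) x₀, e⟫|) (𝓝[>] 0)
          (𝓝 |⟪u t x₀, e⟫ - ⟪heatExtension (u 0) (ν * t) x₀, e⟫|) :=
        ((hlim1.inner (𝕜 := ℝ) (tendsto_const_nhds (x := e))).sub
          (hlim2.inner (𝕜 := ℝ) (tendsto_const_nhds (x := e)))).abs
      rw [hw, inner_sub_left]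
      exact h
    exact le_of_tendsto hT' (eventually_nhdsWithin_of_forall fun ε hε => hreg e ε hε)
  -- take `e = w`
  have hnorm : ‖w‖ ≤ B.toReal := by
    have h := hbound w
    rw [real_inner_self_eq_norm_sq, abs_of_nonneg (sq_nonneg _), sq] at h
    rcases eq_or_lt_of_le (norm_nonneg w) with h0 | hpos
    · rw [← h0]; exact ENNReal.toReal_nonneg
    · exact le_of_mul_le_mul_right (by linarith [h]) hpos
  calc ‖w‖ₑ = ENNReal.ofReal ‖w‖ := (ofReal_norm w).symm
    _ ≤ ENNReal.ofReal B.toReal := ENNReal.ofReal_le_ofReal hnorm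
    _ = B := ENNReal.ofReal_toReal hBtop.ne

/-- **The `L^∞` form of the pointwise majorant WITH force**:
`‖u(t) − e^{νtΔ}u(0)‖_{L^∞} ≤ 2π M_ν(t) + C F_ν(t)` for `t ∈ (0, T]`.
[cite: Tao2011, Prop. 9.1 (proof, (9.2)–(9.7))] -/
theorem eLpNorm_sub_heatExtension_le_speedMajorant_forced (hν : 0 < ν) (hT : 0 < T)
    (hsol : IsClassicalNSSolutionOn (Icc 0 T) ν f u p) (hLH : IsLerayHopfOn T ν f (u 0) u)
    (hfm : AEStronglyMeasurable (uncurry f)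
      ((volume.restrict (Ioo 0 T)).prod (volume : Measure (EuclideanSpace ℝ (Fin 3)))))
    (hf2 : eLpNorm (uncurry f) 2
      ((volume.restrict (Ioo 0 T)).prod (volume : Measure (EuclideanSpace ℝ (Fin 3)))) < ⊤)
    (hfe : ∃ A : ℝ≥0∞, A < ⊤ ∧ ∀ t ∈ Icc 0 T, ∫⁻ x, ‖u t x‖ₑ ^ 2 ≤ A)
    {C : ℝ≥0}
    (hC : ∀ (v : EuclideanSpace ℝ (Fin 3) → EuclideanSpace ℝ (Fin 3)), MemLp v 2 volume →
      ∀ t : ℝ, 0 < t → eLpNorm (heatExtension v t) ∞ volume ≤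
        C * ENNReal.ofReal (t ^ (-(3 / 4 : ℝ))) * eLpNorm v 2 volume)
    {t : ℝ} (ht : t ∈ Ioc 0 T) :
    eLpNorm (fun x => u t x - heatExtension (u 0) (ν * t) x) ∞ volume ≤
      ENNReal.ofReal (2 * π) * (∫⁻ τ in Ioo 0 t, ∑ j, ∑ k,
          ∫⁻ ξ, ‖ξ‖ₑ * ENNReal.ofReal (heatSymbol (ν * (t - τ)) ξ) *
            ‖𝓕 (fun x => ((u τ x j * u τ x k : ℝ) : ℂ)) ξ‖ₑ) +
        C * ∫⁻ τ in Ioo 0 t, ENNReal.ofReal ((ν * (t - τ)) ^ (-(3 / 4 : ℝ))) *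
          eLpNorm (f τ) 2 volume := by
  rw [eLpNorm_exponent_top]
  exact eLpNormEssSup_le_of_ae_enorm_bound (Eventually.of_forall fun x =>
    enorm_sub_heatExtension_le_speedMajorant_forced hν hT hsol hLH hfm hf2 hfe hC ht x)

end Pointwise

/-! ## Time integration -/

section TimeIntegration

variable {T ν : ℝ} {f u : ℝ → EuclideanSpace ℝ (Fin 3) → EuclideanSpace ℝ (Fin 3)}
  {p : ℝ → EuclideanSpace ℝ (Fin 3) → ℝ}

/-- **Measurability of a triangle integral**: for a measurable `m : ℝ → ℝ → ℝ≥0∞`,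
`t ↦ ∫_{τ ∈ (0,t)} m t τ` is measurable. [folklore] -/
private theorem measurable_lintegral_Ioo_var {m : ℝ → ℝ → ℝ≥0∞} (hm : Measurable (uncurry m)) :
    Measurable fun t => ∫⁻ τ in Ioo 0 t, m t τ := by
  have hS : MeasurableSet {q : ℝ × ℝ | 0 < q.2 ∧ q.2 < q.1} :=
    (measurableSet_lt measurable_const measurable_snd).inter
      (measurableSet_lt measurable_snd measurable_fst)
  have h : (fun t => ∫⁻ τ in Ioo 0 t, m t τ) =
      fun t => ∫⁻ τ, {q : ℝ × ℝ | 0 < q.2 ∧ q.2 < q.1}.indicator (uncurry m) (t, τ) := by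
    funext t
    rw [← lintegral_indicator measurableSet_Ioo]
    refine lintegral_congr fun τ => ?_
    simp only [Set.indicator_apply, mem_Ioo, mem_setOf_eq, uncurry]
  rw [h]
  exact (hm.indicator hS).lintegral_prod_right'

/-- **Tonelli on the triangle `{0 < τ < t < T}`, equality form**: for a measurable
`K : ℝ → ℝ → ℝ≥0∞`, `∫_{t∈(0,T)} ∫_{τ∈(0,t)} K t τ = ∫_{τ∈(0,T)} ∫_{t∈(τ,T)} K t τ`. [folklore] -/
private theorem lintegral_Ioo_lintegral_Ioo_eq_swap {K : ℝ → ℝ → ℝ≥0∞} (hK : Measurable (uncurry K))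
    (T : ℝ) :
    ∫⁻ t in Ioo 0 T, ∫⁻ τ in Ioo 0 t, K t τ = ∫⁻ τ in Ioo 0 T, ∫⁻ t in Ioo τ T, K t τ := by
  set g : ℝ → ℝ → ℝ≥0∞ := fun t τ => {q : ℝ × ℝ | q.2 < q.1}.indicator (uncurry K) (t, τ) with hg
  have hgm : Measurable (uncurry g) := by
    have h : uncurry g = {q : ℝ × ℝ | q.2 < q.1}.indicator (uncurry K) := by
      funext q; rfl
    rw [h]
    exact hK.indicator (measurableSet_lt measurable_snd measurable_fst)
  have hL : EqOn (fun t => ∫⁻ τ in Ioo 0 t, K t τ) (fun t => ∫⁻ τ in Ioo 0 T, g t τ) (Ioo 0 T) := by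
    intro t ht
    have hset : Ioo 0 t = Ioo 0 T ∩ Iio t := by
      ext τ
      simp only [mem_Ioo, mem_inter_iff, mem_Iio]
      constructor
      · rintro ⟨h0, hτt⟩
        exact ⟨⟨h0, hτt.trans ht.2⟩, hτt⟩
      · rintro ⟨⟨h0, -⟩, hτt⟩
        exact ⟨h0, hτt⟩
    simp only
    rw [hset, inter_comm, ← Measure.restrict_restrict measurableSet_Iio,
      ← lintegral_indicator measurableSet_Iio]
    refine lintegral_congr fun τ => ?_
    simp only [hg, Set.indicator_apply, mem_Iio, mem_setOf_eq, uncurry]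
  have hR : EqOn (fun τ => ∫⁻ t in Ioo τ T, K t τ) (fun τ => ∫⁻ t in Ioo 0 T, g t τ) (Ioo 0 T) := by
    intro τ hτ
    have hset : Ioo τ T = Ioo 0 T ∩ Ioi τ := by
      ext t
      simp only [mem_Ioo, mem_inter_iff, mem_Ioi]
      constructor
      · rintro ⟨hτt, htT⟩
        exact ⟨⟨hτ.1.trans hτt, htT⟩, hτt⟩
      · rintro ⟨⟨-, htT⟩, hτt⟩
        exact ⟨hτt, htT⟩
    simp only
    rw [hset, inter_comm, ← Measure.restrict_restrict measurableSet_Ioi,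
      ← lintegral_indicator measurableSet_Ioi]
    refine lintegral_congr fun t => ?_
    simp only [hg, Set.indicator_apply, mem_Ioi, mem_setOf_eq, uncurry]
  calc ∫⁻ t in Ioo 0 T, ∫⁻ τ in Ioo 0 t, K t τ = ∫⁻ t in Ioo 0 T, ∫⁻ τ in Ioo 0 T, g t τ :=
        setLIntegral_congr_fun measurableSet_Ioo hL
    _ = ∫⁻ τ in Ioo 0 T, ∫⁻ t in Ioo 0 T, g t τ := lintegral_lintegral_swap hgm.aemeasurable
    _ = ∫⁻ τ in Ioo 0 T, ∫⁻ t in Ioo τ T, K t τ := (setLIntegral_congr_fun measurableSet_Ioo hR).symm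

/-- Translation of a set integral: `∫_{(τ,T)} g(t - τ) dt ≤ ∫_{(0,T)} g` for `τ ≥ 0`. [folklore] -/
private theorem setLIntegral_Ioo_comp_sub_le (g : ℝ → ℝ≥0∞) {τ : ℝ} (hτ : 0 ≤ τ) (T : ℝ) :
    ∫⁻ t in Ioo τ T, g (t - τ) ≤ ∫⁻ s in Ioo 0 T, g s := by
  rw [← lintegral_indicator measurableSet_Ioo, ← lintegral_indicator measurableSet_Ioo]
  have h : (fun t => (Ioo τ T).indicator (fun t => g (t - τ)) t) =
      fun t => (Ioo 0 (T - τ)).indicator g (t - τ) := by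
    funext t
    simp only [Set.indicator_apply, mem_Ioo]
    by_cases h1 : τ < t ∧ t < T
    · rw [if_pos h1, if_pos ⟨sub_pos.2 h1.1, sub_lt_sub_right h1.2 τ⟩]
    · rw [if_neg h1, if_neg (fun h2 => h1 ⟨sub_pos.1 h2.1, by linarith [h2.2]⟩)]
  rw [h, lintegral_sub_right_eq_self (fun s => (Ioo 0 (T - τ)).indicator g s) τ]
  refine lintegral_mono fun s => ?_
  exact Set.indicator_le_indicator_of_subset (Ioo_subset_Ioo le_rfl (by linarith))
    (fun _ => zero_le) s

/-- `∫_{(τ,T)} (ν(t-τ))^{-3/4} dt ≤ ν^{-3/4} · 4T^{1/4}` for `0 ≤ τ`, `0 < ν`, `0 < T`. [folklore] -/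
private theorem setLIntegral_Ioo_rpow_visc_sub_le (hν : 0 < ν) (hT : 0 < T) {τ : ℝ} (hτ : 0 ≤ τ) :
    ∫⁻ t in Ioo τ T, ENNReal.ofReal ((ν * (t - τ)) ^ (-(3 / 4 : ℝ))) ≤
      ENNReal.ofReal (ν ^ (-(3 / 4 : ℝ)) * (4 * T ^ (1 / 4 : ℝ))) := by
  calc ∫⁻ t in Ioo τ T, ENNReal.ofReal ((ν * (t - τ)) ^ (-(3 / 4 : ℝ)))
      ≤ ∫⁻ s in Ioo 0 T, ENNReal.ofReal ((ν * s) ^ (-(3 / 4 : ℝ))) :=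
        setLIntegral_Ioo_comp_sub_le (fun s => ENNReal.ofReal ((ν * s) ^ (-(3 / 4 : ℝ)))) hτ T
    _ = ∫⁻ s in Ioo 0 T, ENNReal.ofReal (ν ^ (-(3 / 4 : ℝ))) * ENNReal.ofReal (s ^ (-(3 / 4 : ℝ))) := by
        refine setLIntegral_congr_fun measurableSet_Ioo fun s hs => ?_
        rw [Real.mul_rpow hν.le hs.1.le, ENNReal.ofReal_mul (Real.rpow_nonneg hν.le _)]
    _ = ENNReal.ofReal (ν ^ (-(3 / 4 : ℝ))) * ENNReal.ofReal (4 * T ^ (1 / 4 : ℝ)) := by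
        rw [lintegral_const_mul' _ _ ENNReal.ofReal_ne_top, lintegral_rpow_neg_three_quarters hT]
    _ = ENNReal.ofReal (ν ^ (-(3 / 4 : ℝ)) * (4 * T ^ (1 / 4 : ℝ))) :=
        (ENNReal.ofReal_mul (Real.rpow_nonneg hν.le _)).symm

/-- **The force majorant integrated in time**: for a measurable `G ≥ 0` on `(0,T)`,
`∫₀ᵀ ∫_{0<τ<t} (ν(t-τ))^{-3/4} G(τ) dτ dt ≤ 4ν^{-3/4}T^{1/4} ∫₀ᵀ G` (Tonelli on the triangle; Tao
2011, proof of Prop. 9.1, the force term of (9.2) integrated via the dispersive bound).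
[cite: Tao2011, Prop. 9.1 (proof, (9.2), force term)] -/
theorem lintegral_lintegral_forceMajorant_le (hν : 0 < ν) (hT : 0 < T) {G : ℝ → ℝ≥0∞}
    (hG : Measurable G) :
    ∫⁻ t in Ioo 0 T, ∫⁻ τ in Ioo 0 t, ENNReal.ofReal ((ν * (t - τ)) ^ (-(3 / 4 : ℝ))) * G τ ≤
      ENNReal.ofReal (ν ^ (-(3 / 4 : ℝ)) * (4 * T ^ (1 / 4 : ℝ))) * ∫⁻ τ in Ioo 0 T, G τ := by
  have hK : Measurable (uncurry fun t τ : ℝ => ENNReal.ofReal ((ν * (t - τ)) ^ (-(3 / 4 : ℝ))) * G τ) := by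
    change Measurable fun q : ℝ × ℝ => ENNReal.ofReal ((ν * (q.1 - q.2)) ^ (-(3 / 4 : ℝ))) * G q.2
    exact (((measurable_const.mul (measurable_fst.sub measurable_snd)).pow_const _).ennreal_ofReal).mul
      (hG.comp measurable_snd)
  rw [lintegral_Ioo_lintegral_Ioo_eq_swap hK T, ← lintegral_const_mul' _ _ ENNReal.ofReal_ne_top]
  refine setLIntegral_mono' measurableSet_Ioo fun τ hτ => ?_
  have hmt : Measurable fun t : ℝ => ENNReal.ofReal ((ν * (t - τ)) ^ (-(3 / 4 : ℝ))) :=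
    ((measurable_const.mul (measurable_id.sub measurable_const)).pow_const _).ennreal_ofReal
  calc ∫⁻ t in Ioo τ T, ENNReal.ofReal ((ν * (t - τ)) ^ (-(3 / 4 : ℝ))) * G τ
      = (∫⁻ t in Ioo τ T, ENNReal.ofReal ((ν * (t - τ)) ^ (-(3 / 4 : ℝ)))) * G τ :=
        lintegral_mul_const _ hmt
    _ ≤ ENNReal.ofReal (ν ^ (-(3 / 4 : ℝ)) * (4 * T ^ (1 / 4 : ℝ))) * G τ :=
        mul_le_mul' (setLIntegral_Ioo_rpow_visc_sub_le hν hT hτ.1.le) le_rfl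

/-- **Time clamp of a classical solution (forced system).** The field
`(τ, x) ↦ u(max 0 (min τ T), x)` is jointly continuous on `ℝ × ℝ³`. [folklore] -/
private theorem continuous_uncurry_timeClamp_forced (hT : 0 < T)
    (hsol : IsClassicalNSSolutionOn (Icc 0 T) ν f u p) :
    Continuous (uncurry fun τ x => u (max 0 (min τ T)) x) := by
  have hc : ContinuousOn (uncurry u) (Icc 0 T ×ˢ univ) := hsol.smooth_velocity.continuousOn
  have hcl : Continuous fun τ : ℝ => max 0 (min τ T) :=
    continuous_const.max (continuous_id.min continuous_const)
  have hmem : ∀ τ : ℝ, max 0 (min τ T) ∈ Icc 0 T := fun τ =>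
    ⟨le_max_left _ _, max_le hT.le (min_le_right _ _)⟩
  exact hc.comp_continuous ((hcl.comp continuous_fst).prodMk continuous_snd)
    fun z => ⟨hmem z.1, mem_univ _⟩

/-- **The time integral of the Fourier majorant along a classical solution of the forced system,
viscosity `ν`**: `∫₀ᵀ M_ν(t) dt ≤ (6S/(ν(2π)⁴)) ∫₀ᵀ ∫|∇u|²_F`.
[cite: Tao2011, Prop. 9.1 (proof, (9.7) and Schur's test)] -/
theorem lintegral_lintegral_speedMajorant_solution_visc_le (hν : 0 < ν) (hT : 0 < T)
    (hsol : IsClassicalNSSolutionOn (Icc 0 T) ν f u p)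
    (hE2 : ∀ t ∈ Icc 0 T, MemLp (u t) 2 volume) :
    ∫⁻ t in Ioo 0 T, ∫⁻ τ in Ioo 0 t, ∑ j, ∑ k,
        ∫⁻ ξ, ‖ξ‖ₑ * ENNReal.ofReal (heatSymbol (ν * (t - τ)) ξ) *
          ‖𝓕 (fun x => ((u τ x j * u τ x k : ℝ) : ℂ)) ξ‖ₑ ≤
      ENNReal.ofReal (6 * schurConst / (ν * (2 * π) ^ 4)) *
        ∫⁻ τ in Ioo 0 T, ∫⁻ x, ENNReal.ofReal (frobeniusNormSq (fderiv ℝ (u τ) x)) := by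
  set U : ℝ → EuclideanSpace ℝ (Fin 3) → EuclideanSpace ℝ (Fin 3) :=
    fun τ => u (max 0 (min τ T)) with hU
  have hUeq : ∀ τ ∈ Ioo 0 T, U τ = u τ := fun τ hτ => by
    simp only [hU, min_eq_left hτ.2.le, max_eq_right hτ.1.le]
  have hUs : ∀ τ ∈ Ioo 0 T, ContDiff ℝ ∞ (U τ) := fun τ hτ => by
    rw [hUeq τ hτ]
    exact hsol.contDiff_velocity ⟨hτ.1.le, hτ.2.le⟩
  have hU2 : ∀ τ ∈ Ioo 0 T, MemLp (U τ) 2 volume := fun τ hτ => by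
    rw [hUeq τ hτ]
    exact hE2 τ ⟨hτ.1.le, hτ.2.le⟩
  have h := lintegral_lintegral_speedMajorant_visc_le hν (continuous_uncurry_timeClamp_forced hT hsol)
    hUs hU2
  have hL : ∫⁻ t in Ioo 0 T, ∫⁻ τ in Ioo 0 t, ∑ j, ∑ k,
        ∫⁻ ξ, ‖ξ‖ₑ * ENNReal.ofReal (heatSymbol (ν * (t - τ)) ξ) *
          ‖𝓕 (fun x => ((u τ x j * u τ x k : ℝ) : ℂ)) ξ‖ₑ =
      ∫⁻ t in Ioo 0 T, ∫⁻ τ in Ioo 0 t, ∑ j, ∑ k,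
        ∫⁻ ξ, ‖ξ‖ₑ * ENNReal.ofReal (heatSymbol (ν * (t - τ)) ξ) *
          ‖𝓕 (fun x => ((U τ x j * U τ x k : ℝ) : ℂ)) ξ‖ₑ := by
    refine setLIntegral_congr_fun measurableSet_Ioo fun t ht => ?_
    refine setLIntegral_congr_fun measurableSet_Ioo fun τ hτ => ?_
    simp only [hUeq τ ⟨hτ.1, hτ.2.trans ht.2⟩]
  have hR : ∫⁻ τ in Ioo 0 T, ∫⁻ x, ENNReal.ofReal (frobeniusNormSq (fderiv ℝ (U τ) x)) =
      ∫⁻ τ in Ioo 0 T, ∫⁻ x, ENNReal.ofReal (frobeniusNormSq (fderiv ℝ (u τ) x)) :=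
    setLIntegral_congr_fun measurableSet_Ioo fun τ hτ => by simp only [hUeq τ hτ]
  rw [hL, ← hR]
  exact h

/-- **Tao 2011, Prop. 9.1 (Bounded total speed) WITH FORCE, qualitative a priori form.** Let
`(u, p)` be a classical solution of the forced Navier–Stokes system with viscosity `ν > 0` on the
closed slab `[0, T] × ℝ³` which is a Leray–Hopf weak solution from `u(0)` with force
`f ∈ L²((0,T) × ℝ³)` (jointly a.e.-strongly measurable), has finite energy `sup_t ∫|u(t)|² < ∞` and
finite dissipation `∫₀ᵀ∫|∇u|²_F < ∞`. Then the total speed is finite: `∫₀ᵀ ‖u(t)‖_{L^∞} dt < ∞`.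
Proof (the printed one, §9, with the force term kept): the tested Duhamel formula (9.2) WITH
force gives `‖u(t)‖_{L^∞} ≤ ‖e^{νtΔ}u(0)‖_{L^∞} + 2π M_ν(t) + C F_ν(t)`; the free term integrates by
the dispersive inequality ((9.6)), the nonlinear majorant by the Schur-test bound
`∫₀ᵀ M_ν ≤ (6S/(ν(2π)⁴)) ∫₀ᵀ∫|∇u|²` ((9.7)), and the force majorant by Tonelli,
`∫₀ᵀ F_ν ≤ 4ν^{-3/4}T^{1/4} ∫₀ᵀ‖f‖_{L²} < ∞`. [cite: Tao2011, Prop. 9.1 (arXiv Prop. 52), proof §9 (9.2)–(9.7)] -/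
theorem lintegral_eLpNorm_top_lt_top_forced (hν : 0 < ν) (hT : 0 < T)
    (hsol : IsClassicalNSSolutionOn (Icc 0 T) ν f u p) (hLH : IsLerayHopfOn T ν f (u 0) u)
    (hfm : AEStronglyMeasurable (uncurry f)
      ((volume.restrict (Ioo 0 T)).prod (volume : Measure (EuclideanSpace ℝ (Fin 3)))))
    (hf2 : eLpNorm (uncurry f) 2
      ((volume.restrict (Ioo 0 T)).prod (volume : Measure (EuclideanSpace ℝ (Fin 3)))) < ⊤)
    (hfe : ∃ A : ℝ≥0∞, A < ⊤ ∧ ∀ t ∈ Icc 0 T, ∫⁻ x, ‖u t x‖ₑ ^ 2 ≤ A)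
    (hD : ∫⁻ t in Ioo 0 T, ∫⁻ x, ENNReal.ofReal (frobeniusNormSq (fderiv ℝ (u t) x)) < ⊤) :
    ∫⁻ t in Ioo 0 T, eLpNorm (u t) ∞ volume < ⊤ := by
  obtain ⟨C, hC⟩ := exists_eLpNorm_top_heatExtension_le
  have hL2 : ∀ s ∈ Icc 0 T, MemLp (u s) 2 volume := hLH.memLp
  have h0T : (0 : ℝ) ∈ Icc 0 T := ⟨le_rfl, hT.le⟩
  have hu02 : MemLp (u 0) 2 volume := hL2 0 h0T
  -- the force slice norms and a measurable modification
  have hIf : ∫⁻ s in Ioo 0 T, eLpNorm (f s) 2 volume < ⊤ :=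
    lintegral_eLpNorm_two_slice_lt_top_of_eLpNorm_prod hfm hf2
  have hF2m : AEMeasurable (fun s => eLpNorm (f s) 2 volume) (volume.restrict (Ioo 0 T)) := by
    have hm : AEMeasurable (fun s => (∫⁻ x, ‖f s x‖ₑ ^ (2 : ℝ) ∂volume) ^ (1 / 2 : ℝ))
        (volume.restrict (Ioo 0 T)) :=
      ((hfm.enorm.pow_const _).lintegral_prod_right').pow_const _
    refine hm.congr (ae_of_all _ fun s => ?_)
    simp only
    rw [eLpNorm_eq_lintegral_rpow_enorm_toReal two_ne_zero ENNReal.ofNat_ne_top, ENNReal.toReal_ofNat]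
  set G : ℝ → ℝ≥0∞ := hF2m.mk _ with hG
  have hGm : Measurable G := hF2m.measurable_mk
  have hGae : (fun s => eLpNorm (f s) 2 volume) =ᵐ[volume.restrict (Ioo 0 T)] G := hF2m.ae_eq_mk
  have hIG : ∫⁻ s in Ioo 0 T, G s < ⊤ := by
    rw [← lintegral_congr_ae hGae]; exact hIf
  -- the three majorants
  set A₁ : ℝ → ℝ≥0∞ := fun t => (C * ENNReal.ofReal (ν ^ (-(3 / 4 : ℝ))) * eLpNorm (u 0) 2 volume) *
    ENNReal.ofReal (t ^ (-(3 / 4 : ℝ))) with hA₁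
  set Fν : ℝ → ℝ≥0∞ := fun t =>
    ∫⁻ τ in Ioo 0 t, ENNReal.ofReal ((ν * (t - τ)) ^ (-(3 / 4 : ℝ))) * G τ with hFν
  -- the clamped field (jointly continuous, agrees with `u` on `[0, T]`) for measurability
  set U : ℝ → EuclideanSpace ℝ (Fin 3) → EuclideanSpace ℝ (Fin 3) :=
    fun τ => u (max 0 (min τ T)) with hU
  have hUeq : ∀ τ ∈ Icc 0 T, U τ = u τ := fun τ hτ => by
    simp only [hU, min_eq_left hτ.2, max_eq_right hτ.1]
  have hUc : Continuous (uncurry U) := continuous_uncurry_timeClamp_forced hT hsol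
  set MU : ℝ → ℝ≥0∞ := fun t => ∫⁻ τ in Ioo 0 t, ∑ j, ∑ k,
      ∫⁻ ξ, ‖ξ‖ₑ * ENNReal.ofReal (heatSymbol (ν * (t - τ)) ξ) *
        ‖𝓕 (fun x => ((U τ x j * U τ x k : ℝ) : ℂ)) ξ‖ₑ with hMU
  have hA₁m : Measurable A₁ := measurable_dispersive_majorant _
  have hMUm : Measurable MU := by
    refine measurable_lintegral_Ioo_var ?_
    change Measurable fun q : ℝ × ℝ => ∑ j, ∑ k,
      ∫⁻ ξ, ‖ξ‖ₑ * ENNReal.ofReal (heatSymbol (ν * (q.1 - q.2)) ξ) *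
        ‖𝓕 (fun x => ((U q.2 x j * U q.2 x k : ℝ) : ℂ)) ξ‖ₑ
    refine Finset.measurable_sum _ fun j _ => Finset.measurable_sum _ fun k _ => ?_
    exact (measurable_speedMajorant_integrand_visc ν hUc j k).lintegral_prod_right'
  have hFνm : Measurable Fν := by
    refine measurable_lintegral_Ioo_var ?_
    change Measurable fun q : ℝ × ℝ => ENNReal.ofReal ((ν * (q.1 - q.2)) ^ (-(3 / 4 : ℝ))) * G q.2
    exact (((measurable_const.mul (measurable_fst.sub measurable_snd)).pow_const _).ennreal_ofReal).mul
      (hGm.comp measurable_snd)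
  -- the pointwise bound on `(0, T)`
  have hpt : ∀ t ∈ Ioo 0 T, eLpNorm (u t) ∞ volume ≤
      A₁ t + (ENNReal.ofReal (2 * π) * MU t + C * Fν t) := by
    intro t ht
    have htT : t ∈ Icc 0 T := Ioo_subset_Icc_self ht
    have hνt : 0 < ν * t := mul_pos hν ht.1
    have hm1 : AEStronglyMeasurable (heatExtension (u 0) (ν * t)) volume :=
      (memLp_heatExtension_holds hu02 (by norm_num) hνt).1
    have hm2 : AEStronglyMeasurable (fun x => u t x - heatExtension (u 0) (ν * t) x) volume :=
      (hsol.contDiff_velocity htT).continuous.aestronglyMeasurable.sub hm1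
    have heq : (heatExtension (u 0) (ν * t) + fun x => u t x - heatExtension (u 0) (ν * t) x) =
        u t := by
      funext x
      simp only [Pi.add_apply, add_sub_cancel]
    -- the free term
    have hfree : eLpNorm (heatExtension (u 0) (ν * t)) ∞ volume ≤ A₁ t := by
      calc eLpNorm (heatExtension (u 0) (ν * t)) ∞ volume
          ≤ C * ENNReal.ofReal ((ν * t) ^ (-(3 / 4 : ℝ))) * eLpNorm (u 0) 2 volume :=
            hC _ hu02 _ hνt
        _ = A₁ t := by
            rw [hA₁, Real.mul_rpow hν.le ht.1.le, ENNReal.ofReal_mul (Real.rpow_nonneg hν.le _)]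
            ring
    -- the Duhamel terms: the theorem, then `u ↦ U` on `(0, t)` and `‖f(·)‖₂ ↦ G` a.e.
    have hduh := eLpNorm_sub_heatExtension_le_speedMajorant_forced hν hT hsol hLH hfm hf2 hfe hC
      ⟨ht.1, ht.2.le⟩
    have hM_eq : (∫⁻ τ in Ioo 0 t, ∑ j, ∑ k,
        ∫⁻ ξ, ‖ξ‖ₑ * ENNReal.ofReal (heatSymbol (ν * (t - τ)) ξ) *
          ‖𝓕 (fun x => ((u τ x j * u τ x k : ℝ) : ℂ)) ξ‖ₑ) = MU t := by
      simp only [hMU]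
      refine setLIntegral_congr_fun measurableSet_Ioo fun τ hτ => ?_
      rw [hUeq τ ⟨hτ.1.le, (hτ.2.trans ht.2).le⟩]
    have hF_eq : (∫⁻ τ in Ioo 0 t, ENNReal.ofReal ((ν * (t - τ)) ^ (-(3 / 4 : ℝ))) *
        eLpNorm (f τ) 2 volume) = Fν t := by
      simp only [hFν]
      refine lintegral_congr_ae ?_
      have hae : (fun s => eLpNorm (f s) 2 volume) =ᵐ[volume.restrict (Ioo 0 t)] G :=
        ae_mono (Measure.restrict_mono (Ioo_subset_Ioo le_rfl ht.2.le) le_rfl) hGae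
      filter_upwards [hae] with τ hτ
      rw [hτ]
    rw [hM_eq, hF_eq] at hduh
    calc eLpNorm (u t) ∞ volume
        = eLpNorm (heatExtension (u 0) (ν * t) +
            fun x => u t x - heatExtension (u 0) (ν * t) x) ∞ volume := by rw [heq]
      _ ≤ eLpNorm (heatExtension (u 0) (ν * t)) ∞ volume +
            eLpNorm (fun x => u t x - heatExtension (u 0) (ν * t) x) ∞ volume :=
          eLpNorm_add_le hm1 hm2 le_top
      _ ≤ A₁ t + (ENNReal.ofReal (2 * π) * MU t + C * Fν t) := add_le_add hfree hduh
  -- integrate in time: the three pieces are finite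
  have hI₁ : ∫⁻ t in Ioo 0 T, A₁ t < ⊤ := by
    simp only [hA₁]
    rw [lintegral_const_mul' _ _ (ENNReal.mul_ne_top (ENNReal.mul_ne_top ENNReal.coe_ne_top
      ENNReal.ofReal_ne_top) hu02.eLpNorm_ne_top), lintegral_rpow_neg_three_quarters hT]
    exact ENNReal.mul_lt_top (ENNReal.mul_ne_top (ENNReal.mul_ne_top ENNReal.coe_ne_top
      ENNReal.ofReal_ne_top) hu02.eLpNorm_ne_top).lt_top ENNReal.ofReal_lt_top
  have hI₂ : ∫⁻ t in Ioo 0 T, MU t < ⊤ := by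
    have hUs : ∀ τ ∈ Ioo 0 T, ContDiff ℝ ∞ (U τ) := fun τ hτ => by
      rw [hUeq τ (Ioo_subset_Icc_self hτ)]
      exact hsol.contDiff_velocity (Ioo_subset_Icc_self hτ)
    have hU2 : ∀ τ ∈ Ioo 0 T, MemLp (U τ) 2 volume := fun τ hτ => by
      rw [hUeq τ (Ioo_subset_Icc_self hτ)]
      exact hL2 τ (Ioo_subset_Icc_self hτ)
    have h := lintegral_lintegral_speedMajorant_visc_le hν hUc hUs hU2
    have hR : ∫⁻ τ in Ioo 0 T, ∫⁻ x, ENNReal.ofReal (frobeniusNormSq (fderiv ℝ (U τ) x)) =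
        ∫⁻ τ in Ioo 0 T, ∫⁻ x, ENNReal.ofReal (frobeniusNormSq (fderiv ℝ (u τ) x)) :=
      setLIntegral_congr_fun measurableSet_Ioo fun τ hτ => by
        simp only [hUeq τ (Ioo_subset_Icc_self hτ)]
    rw [hR] at h
    exact lt_of_le_of_lt h (ENNReal.mul_lt_top ENNReal.ofReal_lt_top hD)
  have hI₃ : ∫⁻ t in Ioo 0 T, Fν t < ⊤ :=
    lt_of_le_of_lt (lintegral_lintegral_forceMajorant_le hν hT hGm)
      (ENNReal.mul_lt_top ENNReal.ofReal_lt_top hIG)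
  calc ∫⁻ t in Ioo 0 T, eLpNorm (u t) ∞ volume
      ≤ ∫⁻ t in Ioo 0 T, (A₁ t + (ENNReal.ofReal (2 * π) * MU t + C * Fν t)) :=
        setLIntegral_mono' measurableSet_Ioo hpt
    _ = (∫⁻ t in Ioo 0 T, A₁ t) + ((ENNReal.ofReal (2 * π) * ∫⁻ t in Ioo 0 T, MU t) +
          C * ∫⁻ t in Ioo 0 T, Fν t) := by
        rw [lintegral_add_left' hA₁m.aemeasurable, lintegral_add_left' (hMUm.const_mul _).aemeasurable,
          lintegral_const_mul' _ _ ENNReal.ofReal_ne_top, lintegral_const_mul' _ _ ENNReal.coe_ne_top]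
    _ < ⊤ := ENNReal.add_lt_top.2 ⟨hI₁, ENNReal.add_lt_top.2
        ⟨ENNReal.mul_lt_top ENNReal.ofReal_lt_top hI₂, ENNReal.mul_lt_top ENNReal.coe_lt_top hI₃⟩⟩

end TimeIntegration

/-! ## Cor. 11.4 WITH a Clay-class force: the assembly -/

section ClayAssembly

variable {f : ℝ → EuclideanSpace ℝ (Fin 3) → EuclideanSpace ℝ (Fin 3)}

/-- **A Clay-class force is jointly measurable on the slab `(0,T) × ℝ³`** (it is continuous on
`[0,∞) × ℝ³`). [cite: FeffermanClay2006, (5)–(6)] -/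
theorem clayForce_prod_aestronglyMeasurable {T : ℝ} (hfs : IsSmoothOnHalfSpace f) :
    AEStronglyMeasurable (uncurry f)
      ((volume.restrict (Ioo 0 T)).prod (volume : Measure (EuclideanSpace ℝ (Fin 3)))) := by
  have hc : ContinuousOn (uncurry f) (Ioo 0 T ×ˢ (univ : Set (EuclideanSpace ℝ (Fin 3)))) :=
    hfs.continuousOn.mono (prod_mono (fun t ht => mem_Ici.2 ht.1.le) subset_rfl)
  have h1 : AEStronglyMeasurable (uncurry f)
      (((volume : Measure ℝ).prod (volume : Measure (EuclideanSpace ℝ (Fin 3)))).restrict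
        (Ioo 0 T ×ˢ univ)) :=
    hc.aestronglyMeasurable (measurableSet_Ioo.prod MeasurableSet.univ)
  rw [← Measure.prod_restrict, Measure.restrict_univ] at h1
  exact h1

/-- **A Clay-class force is in `L²((0,T) × ℝ³)`** for `0 < T` (uniform `L²` slice bound times
the length of the time interval; Tonelli). [cite: FeffermanClay2006, (5)] -/
theorem clayForce_prod_eLpNorm_lt_top {T : ℝ} (hfs : IsSmoothOnHalfSpace f)
    (hfd : HasRapidSpaceTimeDecay f) :
    eLpNorm (uncurry f) 2
      ((volume.restrict (Ioo 0 T)).prod (volume : Measure (EuclideanSpace ℝ (Fin 3)))) < ⊤ := by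
  obtain ⟨Cf, Pf, hCft, -, hb⟩ := clayForce_slice_potential_bounds (T := T) hfs hfd
  have hm := clayForce_prod_aestronglyMeasurable (T := T) hfs
  rw [eLpNorm_lt_top_iff_lintegral_rpow_enorm_lt_top two_ne_zero ENNReal.ofNat_ne_top,
    ENNReal.toReal_ofNat, lintegral_prod _ (hm.enorm.pow_const _)]
  have hin : ∀ t ∈ Ioo 0 T, ∫⁻ x, ‖uncurry f (t, x)‖ₑ ^ (2 : ℝ) ≤ Cf := by
    intro t ht
    refine le_trans (le_of_eq (lintegral_congr fun x => ?_)) (hb t (Ioo_subset_Icc_self ht)).1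
    simp only [uncurry, ENNReal.rpow_two]
  calc ∫⁻ t in Ioo 0 T, ∫⁻ x, ‖uncurry f (t, x)‖ₑ ^ (2 : ℝ)
      ≤ ∫⁻ _ in Ioo 0 T, Cf := setLIntegral_mono' measurableSet_Ioo fun t ht => hin t ht
    _ < ⊤ := by
        rw [setLIntegral_const, Real.volume_Ioo]
        exact ENNReal.mul_lt_top hCft ENNReal.ofReal_lt_top

/-- **Prop. 9.1 WITH a Clay-class force: finite total speed.** A classical solution of the forced
system (`ν > 0`) on `[0,T] × ℝ³`, `T > 0`, with finite energy and a Clay-class force has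
`∫₀ᵀ ‖u(t)‖_{L^∞} dt < ∞` (`lintegral_eLpNorm_top_lt_top_forced`, its Leray–Hopf, `L²_{t,x}`-force
and dissipation hypotheses discharged for the Clay class). [cite: Tao2011, Prop. 9.1 (arXiv Prop. 52) with Lemma 8.1 and Lemma 4.1 (i)] -/
theorem IsClassicalNSSolutionOn.totalSpeed_lt_top_of_clayForce {ν T : ℝ}
    {u : ℝ → EuclideanSpace ℝ (Fin 3) → EuclideanSpace ℝ (Fin 3)}
    {p : ℝ → EuclideanSpace ℝ (Fin 3) → ℝ} (hsol : FluidPDE.IsClassicalNSSolutionOn (Icc 0 T) ν f u p)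
    (hν : 0 < ν) (hT : 0 < T) (hfs : IsSmoothOnHalfSpace f) (hfd : HasRapidSpaceTimeDecay f)
    (hE : ∃ A : ℝ≥0∞, A < ⊤ ∧ ∀ t ∈ Icc 0 T, ∫⁻ x, ‖u t x‖ₑ ^ 2 ≤ A) :
    ∫⁻ t in Ioo 0 T, eLpNorm (u t) ∞ volume < ⊤ := by
  obtain ⟨Cf, Pf, hCft, hPft, hb⟩ := clayForce_slice_potential_bounds (T := T) hfs hfd
  have hLH : IsLerayHopfOn T ν f (u 0) u :=
    (hsol.isLerayHopfOn_of_finiteEnergy_forced_ae tao2011_forced_pressure_normalisation_ae_holds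
      hν hT hCft.ne (fun t ht => (hb t ht).1) hPft.ne (fun t ht => (hb t ht).2.1)
      (fun t ht => (hb t ht).2.2) hE).1
  exact lintegral_eLpNorm_top_lt_top_forced hν hT hsol hLH (clayForce_prod_aestronglyMeasurable hfs)
    (clayForce_prod_eLpNorm_lt_top hfs hfd) hE (hsol.dissipation_lt_top_of_clayForce hν hT hfs hfd hE)

/-- **Tao 2011, Cor. 11.4 (Unconditional uniqueness, arXiv Cor. 71) WITH a Clay-class (Schwartz)
force, velocity form — PROVED.** For `ν > 0`, `0 < T`, a datum `u₀` with `u₀, ∇u₀ ∈ L²`, a force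
`f` smooth on `[0, ∞) × ℝ³` with Fefferman's space-time decay (5), and two classical solutions
`(u, p)`, `(v, q)` of the forced system on the closed slab `[0, T] × ℝ³` with `u 0 = v 0 = u₀` and
finite energy `sup_{[0,T]} ∫|u|² < ∞`, `sup_{[0,T]} ∫|v|² < ∞`, the velocities agree on `[0, T]`.
This is verbatim the conclusion of `tao2011_forced_unconditionalUniqueness_velocity.schwartzForce`
— the hypothesis `tao_unconditional_uniqueness_velocity_forced` of the E–C bridge — with the named
fact replaced by the proof: Prop. 9.1 WITH force (`totalSpeed_lt_top_of_clayForce`) fed into the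
reduction `tao2011_forced_unconditionalUniqueness_velocity_schwartzForce_of_totalSpeed` (Cor. 11.1
WITH force, Lemma 8.1 WITH force, and the energy/Gronwall uniqueness in `X¹`, Remark 11.3).
[cite: Tao2011, Cor. 11.4 (arXiv Cor. 71, p. 36) + Remark 11.3] -/
theorem tao2011_forced_unconditionalUniqueness_velocity_schwartzForce_holds :
    ∀ (ν T : ℝ), 0 < ν → 0 < T →
    ∀ (u₀ : EuclideanSpace ℝ (Fin 3) → EuclideanSpace ℝ (Fin 3)),
      MemLp u₀ 2 volume → MemLp (fderiv ℝ u₀) 2 volume →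
    ∀ (f : ℝ → EuclideanSpace ℝ (Fin 3) → EuclideanSpace ℝ (Fin 3)),
      IsSmoothOnHalfSpace f → HasRapidSpaceTimeDecay f →
    ∀ (u v : ℝ → EuclideanSpace ℝ (Fin 3) → EuclideanSpace ℝ (Fin 3))
      (p q : ℝ → EuclideanSpace ℝ (Fin 3) → ℝ),
      IsClassicalNSSolutionOn (Icc 0 T) ν f u p →
      IsClassicalNSSolutionOn (Icc 0 T) ν f v q →
      u 0 = u₀ → v 0 = u₀ →
      (∃ C : ℝ≥0∞, C < ⊤ ∧ ∀ t ∈ Icc 0 T, ∫⁻ x, ‖u t x‖ₑ ^ 2 ≤ C) →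
      (∃ C : ℝ≥0∞, C < ⊤ ∧ ∀ t ∈ Icc 0 T, ∫⁻ x, ‖v t x‖ₑ ^ 2 ≤ C) →
      ∀ t ∈ Icc 0 T, u t = v t := by
  intro ν T hν hT u₀ h₀ h₁ f hfs hfd u v p q hu hv hu0 hv0 hEu hEv
  exact tao2011_forced_unconditionalUniqueness_velocity_schwartzForce_of_totalSpeed hν hT h₀ h₁ hfs
    hfd hu hv hu0 hv0 hEu hEv (hu.totalSpeed_lt_top_of_clayForce hν hT hfs hfd hEu)
    (hv.totalSpeed_lt_top_of_clayForce hν hT hfs hfd hEv)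

/-- The same theorem in the binder form of the tree's corollary: the specialisation
`tao2011_forced_unconditionalUniqueness_velocity.schwartzForce h` no longer needs its hypothesis
`h`. [cite: Tao2011, Cor. 11.4 (arXiv Cor. 71, p. 36)] -/
theorem tao2011_forced_unconditionalUniqueness_velocity_schwartzForce_holds'
    {ν T : ℝ} (hν : 0 < ν) (hT : 0 < T)
    {u₀ : EuclideanSpace ℝ (Fin 3) → EuclideanSpace ℝ (Fin 3)}
    (h₀ : MemLp u₀ 2 volume) (h₁ : MemLp (fderiv ℝ u₀) 2 volume)
    (hfs : IsSmoothOnHalfSpace f) (hfd : HasRapidSpaceTimeDecay f)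
    {u v : ℝ → EuclideanSpace ℝ (Fin 3) → EuclideanSpace ℝ (Fin 3)}
    {p q : ℝ → EuclideanSpace ℝ (Fin 3) → ℝ}
    (hu : FluidPDE.IsClassicalNSSolutionOn (Icc 0 T) ν f u p)
    (hv : FluidPDE.IsClassicalNSSolutionOn (Icc 0 T) ν f v q)
    (hu0 : u 0 = u₀) (hv0 : v 0 = u₀)
    (hEu : ∃ C : ℝ≥0∞, C < ⊤ ∧ ∀ t ∈ Icc 0 T, ∫⁻ x, ‖u t x‖ₑ ^ 2 ≤ C)
    (hEv : ∃ C : ℝ≥0∞, C < ⊤ ∧ ∀ t ∈ Icc 0 T, ∫⁻ x, ‖v t x‖ₑ ^ 2 ≤ C) :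
    ∀ t ∈ Icc 0 T, u t = v t :=
  tao2011_forced_unconditionalUniqueness_velocity_schwartzForce_holds ν T hν hT u₀ h₀ h₁ f hfs hfd
    u v p q hu hv hu0 hv0 hEu hEv

end ClayAssembly

end Literature.Analysis.FluidPDE

end
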